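import Summits.HodgeConjecture.HodgeConjecture.Theorems.DworkReflectionQuotientsGIOfGriffithsQP
import Literature.AlgebraicGeometry.HodgeTheory.GriffithsHolomorphicHodgeSubbundlesQPHolds
import HarnessLib

/-!
# Route `DworkReflectionQuotients`: the «Griffiths 1968 general» input of the floor DISCHARGED — the crux
# `GenericInvariantHodgeClasses` BY NAME modulo the Carlson–Griffiths residues alone, and the rung leaf modulo
# {Bini–Garbagnati 3.20, Kollár–Miyaoka–Mori, residues}

Route `route-HodgeConjecture-DworkReflectionQuotients` (cell `hodge-nonav`; FRONTIER rung F-H1 — never summit credit). Prover seat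
`hodge-nonav-20241-p1` (g20). SUPPORT FILE (`--supports stmt-HodgeConjecture-24129`; CONDITIONAL results, nothing here closes an item).
One application each of the cell's theorem `griffiths1968_holomorphicHodgeSubbundlesQP_holds` (programme GRIFFITHS-HOLOMORPHY of
prover-Bx, bricks by 19716-p2 ∕ 20241-p1 ∕ prover-Bx; `GriffithsHolomorphicHodgeSubbundlesQPHolds`) — Griffiths' theorem
«`F^p𝓗^k` is a holomorphic subbundle» for smooth projective families with quasi-projective total space, KERNEL-CHECKED — to the three
QP-conditional theorems of `DworkReflectionQuotientsGIOfGriffithsQP`: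

* `genericInvariantHodgeClasses_of_residues` — crux GI (stmt-HodgeConjecture-24129) BY NAME modulo ONE named fact,
  `DworkSextic.Voisin2003_dworkPencil_residues_infinitesimal` (Carlson–Griffiths residues of pole order 3 along the pencil + IVHS);
* `genericHodgeClassesFlat_of_isFano_of_KMM_of_residues` — support `GenericHodgeClassesFlat` (stmt-HodgeConjecture-20243) BY NAME
  modulo {Bini–Garbagnati Prop. 3.20, Kollár–Miyaoka–Mori, residues};
* `dworkSexticHodge_of_isFano_of_KMM_of_residues` — the rung leaf `DworkSexticHodge` BY NAME modulo the same three print facts.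

New floor of the route: {`DworkSextic.BiniGarbagnati2012_reflectionQuotient_isFano`, `KollarMiyaokaMori1992_fano_rationallyChainConnected`,
`DworkSextic.Voisin2003_dworkPencil_residues_infinitesimal`} — Griffiths 1968 is no longer an input.

Honest scope: conditional structure theorems; nothing here says HC, HC_CM or HC_AV is proved; rung F-H1 not moved.

## References

* [VoisinHodgeI2002] C. Voisin, Hodge Theory and Complex Algebraic Geometry I (2002), §10.2.1 Thm. 10.3.
* [VoisinHodgeII2003] C. Voisin, Hodge Theory and Complex Algebraic Geometry II (2003), §5.3.1 Lemma 5.13, Thm. 6.13, Thm. 6.24 (proof).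
* [BiniGarbagnati2012] G. Bini, A. Garbagnati, Quotients of the Dwork pencil, J. Geom. Phys. 75 (2014), Prop. 3.20.
* [KollarMiyaokaMori1992] J. Kollár, Y. Miyaoka, S. Mori, Rational connectedness and boundedness of Fano manifolds, J. Differential
  Geom. 36 (1992), Thm. 0.1.
* [Griffiths1968PeriodsII] P. Griffiths, Periods of integrals on algebraic manifolds II, Amer. J. Math. 90 (1968), Thm. 1.1.
-/

-- mandated namespace `Summit.HodgeConjecture.HodgeConjecture.Theorems` trips `linter.dupNamespace` (off tree-wide)
set_option linter.dupNamespace false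

namespace Summit.HodgeConjecture.HodgeConjecture.Theorems

open Literature.AlgebraicGeometry.HodgeTheory Literature.AlgebraicGeometry.Motives

/-- **Crux GI `GenericInvariantHodgeClasses` (stmt-HodgeConjecture-24129) BY NAME modulo the Carlson–Griffiths residues along the
pencil ALONE** — Griffiths' theorem (QP form) is the cell's theorem `griffiths1968_holomorphicHodgeSubbundlesQP_holds`. CONDITIONAL on
`DworkSextic.Voisin2003_dworkPencil_residues_infinitesimal`; rung F-H1 not moved. [cite: VoisinHodgeI2002, §10.2.1 Thm. 10.3]
[cite: Griffiths1968PeriodsII, Thm. 1.1] [cite: VoisinHodgeII2003, Thm. 6.13 and Thm. 6.24 (proof)] -/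
theorem genericInvariantHodgeClasses_of_residues
    (hres : DworkSextic.Voisin2003_dworkPencil_residues_infinitesimal) :
    Summit.HodgeConjecture.HodgeConjecture.Theses.DworkReflectionQuotients.GenericInvariantHodgeClasses :=
  genericInvariantHodgeClasses_of_griffiths1968QP_of_residues griffiths1968_holomorphicHodgeSubbundlesQP_holds hres

/-- **The support `GenericHodgeClassesFlat` (stmt-HodgeConjecture-20243) BY NAME from {Bini–Garbagnati 3.20, Kollár–Miyaoka–Mori,
pencil residues}** (Griffiths 1968 discharged by `griffiths1968_holomorphicHodgeSubbundlesQP_holds`). CONDITIONAL; rung F-H1 not moved.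
[cite: BiniGarbagnati2012, Prop. 3.20] [cite: KollarMiyaokaMori1992, Thm. 0.1] [cite: VoisinHodgeII2003, Thm. 6.24 (proof)] -/
theorem genericHodgeClassesFlat_of_isFano_of_KMM_of_residues
    (hF : DworkSextic.BiniGarbagnati2012_reflectionQuotient_isFano)
    (hK : KollarMiyaokaMori1992_fano_rationallyChainConnected)
    (hres : DworkSextic.Voisin2003_dworkPencil_residues_infinitesimal) :
    Summit.HodgeConjecture.HodgeConjecture.Theses.DworkReflectionQuotients.GenericHodgeClassesFlat :=
  genericHodgeClassesFlat_of_isFano_of_KMM_of_griffiths1968QP_of_residues hF hK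
    griffiths1968_holomorphicHodgeSubbundlesQP_holds hres

/-- **The rung leaf `DworkSexticHodge` (HC for the very general Dwork sextic fourfold) BY NAME from {Bini–Garbagnati Prop. 3.20,
Kollár–Miyaoka–Mori, Carlson–Griffiths residues along the pencil}** — three print facts; Griffiths' theorem «`F^p𝓗^k` holomorphic» is
now the cell's kernel-checked `griffiths1968_holomorphicHodgeSubbundlesQP_holds`. CONDITIONAL; FRONTIER rung F-H1, never summit credit;
nothing here says HC, HC_CM or HC_AV is proved. [cite: BiniGarbagnati2012, Prop. 3.20] [cite: KollarMiyaokaMori1992, Thm. 0.1]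
[cite: VoisinHodgeII2003, Thm. 6.13 and Thm. 6.24 (proof)] [cite: Griffiths1968PeriodsII, Thm. 1.1] -/
theorem dworkSexticHodge_of_isFano_of_KMM_of_residues
    (hF : DworkSextic.BiniGarbagnati2012_reflectionQuotient_isFano)
    (hK : KollarMiyaokaMori1992_fano_rationallyChainConnected)
    (hres : DworkSextic.Voisin2003_dworkPencil_residues_infinitesimal) :
    Summit.HodgeConjecture.HodgeConjecture.Theses.DworkPrymHodge.DworkSexticHodge :=
  dworkSexticHodge_of_isFano_of_KMM_of_griffiths1968QP_of_residues hF hK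
    griffiths1968_holomorphicHodgeSubbundlesQP_holds hres

end Summit.HodgeConjecture.HodgeConjecture.Theorems
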